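import Literature.Computability.AlgebraicComplexity.BurgisserFiniteFieldsProofs
import Literature.Computability.AlgebraicComplexity.ValiantHCCompleteness
import Literature.Computability.AlgebraicComplexity.ValiantConjectureCompleteCriterion
import Literature.Computability.AlgebraicComplexity.CommutativeExtensionSimulation
import Literature.Computability.AlgebraicComplexity.ArithCircuitProofs

/-!
# Route BoolTransfer — support item `FpBarDegreeCollapse` (T1 rung of `FpBarCollapse`)

Route `route-ValiantsHypothesis-BoolTransfer`, item `stmt-ValiantsHypothesis-21046`
(`FpBarDegreeCollapse`, the tenure-sweep rung T1 of the crux `FpBarCollapse`, stmt-1318), stated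
VERBATIM (the route file had not been re-rendered with this decl when this file was written, so the
statement is spelled out rather than named):

> for a prime `p` and a constant `c`: if EVERY Hamiltonian-cycle polynomial `HC_n` has a
> fan-in-two circuit of size `≤ (n+1)^c` whose constants lie in the degree-`(n+1)^c` extension
> `GaloisField p ((n+1)^c)` of `𝔽_p` (computing the image of `hcPoly (Fin n) (ZMod p)`), then
> `NP ⊆ P/poly`.

This is the DEGREE-BOUNDED part of Bürgisser's open `𝔽̄_p` collapse problem (Bürgisser 2000 TCS,
p. 74): circuits over `𝔽̄_p` whose constants have polynomially bounded degree over `𝔽_p` descend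
to `𝔽_p` at polynomial cost, and over the FINITE field `𝔽_p` the Boolean collapse is Bürgisser's
Cor. 1.2(2), unconditional and in the tree.

Proof (composition of landed results, no new mathematics):
* restriction of scalars for circuit complexity — the commutative case of Hrubeš–Yehudayoff
  2011 Thm. 4.2 in the tree (`CommExtSim.complexity_lmap_le`, structure-constant simulation:
  `L_F(φ(G)) ≤ (5d³ + 6d² + 2d)·L_E(G) + 3d` for `[E:F] = d` and an `F`-linear `φ : E → F`;
  with `φ(1) = 1` one has `φ(f ⊗ E) = f`), exactly as in the landed route item
  `GaugeDescent.ScalarRestriction` (`Theorems/GaugeDescentScalarRestriction.lean`, whose wrapper is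
  re-derived here in 15 lines so that this file imports no route file), with
  `[GaloisField p r : 𝔽_p] = r` (`GaloisField.finrank`): `L_{𝔽_p}(HC_n) ≤ 16 (n+1)^{4c}`, so
  `(HC_n)` is p-computable over `ZMod p` (`complexity_le_of_map_galoisField`,
  `isPComputable_hcPoly_zmod_of_galoisField`);
* `HC` is a p-family and `VNP`-complete over every field
  (`isVNPComplete_hcPoly_holds`, Valiant 1979), hence `VP_{𝔽_p} = VNP_{𝔽_p}`
  (`VP_eq_VNP_iff_isVPFamily_of_isVNPComplete`);
* Bürgisser 2000 TCS Cor. 1.2(2) for finite fields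
  (`NP_subset_PPoly_of_VP_eq_VNP_finite` fed with the discharged facts
  `polyAdvice_NP_subset_polyAdvice_ModpNP_holds` (Thm. 3.1) and
  `booleanPart_VP_NC_two_of_finite_holds` (BP(VP_k) ⊆ FNC²/poly)) gives `NP ⊆ P/poly`.

What it leaves open toward the crux `FpBarCollapse` (stmt-1318): circuits over `𝔽̄_p` whose
constants have degree SUPER-polynomial in `n` (Bürgisser 2000 §4.3). Honest framing: a conditional
collapse statement; nothing here bears on `VP ≠ VNP`.

## References
* [Burgisser2000TCS] P. Bürgisser, *Cook's versus Valiant's hypothesis*, TCS 235 (2000), Cor. 1.2(2)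
  p. 74 and §4.3.
* [Burgisser2000] P. Bürgisser, *Completeness and Reduction in Algebraic Complexity Theory*,
  Cor. 4.6(2).
* [Valiant1979] L. Valiant, *Completeness classes in algebra*, STOC 1979.
-/

-- Sub = Summit layout duplicates the namespace component
set_option linter.dupNamespace false

namespace Summit.ValiantsHypothesis.ValiantsHypothesis.Theorems.BoolTransfer

open Literature.Computability.AlgebraicComplexity Literature.Computability.Complexity

/-- **Restriction of scalars to `𝔽_p` from a Galois field** (commutative Hrubeš–Yehudayoff
simulation, tree `CommExtSim.complexity_lmap_le`, through an `𝔽_p`-linear functional `φ` on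
`GaloisField p r` with `φ 1 = 1`): for `r ≠ 0` and `q ∈ 𝔽_p[x_σ]`,
`L_{𝔽_p}(q) ≤ (5r³ + 6r² + 2r) · L_{𝔽_{p^r}}(q) + 3r`. -/
theorem complexity_le_of_map_galoisField (p : ℕ) [Fact p.Prime] {r : ℕ} (hr : r ≠ 0)
    {σ : Type} [Fintype σ] (q : MvPolynomial σ (ZMod p)) :
    complexity q ≤ (5 * r ^ 3 + 6 * r ^ 2 + 2 * r) *
        complexity (MvPolynomial.map (algebraMap (ZMod p) (GaloisField p r)) q) + 3 * r := by
  classical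
  obtain ⟨ψ, hψ⟩ : ∃ ψ : Module.Dual (ZMod p) (GaloisField p r), ψ 1 ≠ 0 := by
    by_contra h
    push Not at h
    exact one_ne_zero ((Module.forall_dual_apply_eq_zero_iff (ZMod p) (1 : GaloisField p r)).1 h)
  set φ : GaloisField p r →ₗ[ZMod p] ZMod p := (ψ 1)⁻¹ • ψ with hφ
  have hφ1 : φ 1 = 1 := by
    simp only [hφ, LinearMap.smul_apply, smul_eq_mul, inv_mul_cancel₀ hψ]
  have hq : CommExtSim.lmap φ (MvPolynomial.map (algebraMap (ZMod p) (GaloisField p r)) q) = q := by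
    have h := CommExtSim.lmap_C_mul_map φ (1 : GaloisField p r) q
    rwa [MvPolynomial.C_1, one_mul, hφ1, one_smul] at h
  have hmain := CommExtSim.complexity_lmap_le (Module.finBasis (ZMod p) (GaloisField p r)) φ
    (MvPolynomial.map (algebraMap (ZMod p) (GaloisField p r)) q)
  rwa [hq, Fintype.card_fin, GaloisField.finrank p hr] at hmain

/-- **p-computability of `HC` over `𝔽_p` from small circuits with low-degree constants.** If every
`HC_n` has a fan-in-two circuit of size `≤ (n+1)^c` over `GaloisField p ((n+1)^c)` computing the
image of `hcPoly (Fin n) (ZMod p)`, then the family `(HC_n)_n` is p-computable over `ZMod p`: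
`L_{𝔽_p}(HC_n) ≤ 16 (n+1)^{4c}` (restriction of scalars at degree `r = (n+1)^c`). -/
theorem isPComputable_hcPoly_zmod_of_galoisField (p : ℕ) [Fact p.Prime] (c : ℕ)
    (h : ∀ n : ℕ, ∃ P : ArithCircuit (GaloisField p ((n + 1) ^ c)) (Fin n × Fin n),
      P.IsFanInTwo ∧ P.Computes (MvPolynomial.map (algebraMap (ZMod p) (GaloisField p ((n + 1) ^ c)))
        (hcPoly (Fin n) (ZMod p))) ∧ P.size ≤ (n + 1) ^ c) :
    IsPComputable (fun n => hcPoly (Fin n) (ZMod p)) := by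
  refine (IsPBounded.iff_exists_le_mul_succ_pow _).2 ⟨16, 4 * c, fun n => ?_⟩
  obtain ⟨P, hP2, hPc, hPs⟩ := h n
  set D : ℕ := (n + 1) ^ c with hD
  have hD0 : D ≠ 0 := pow_ne_zero c (Nat.succ_ne_zero n)
  have hD1 : 1 ≤ D := Nat.one_le_iff_ne_zero.2 hD0
  have hL : complexity (MvPolynomial.map (algebraMap (ZMod p) (GaloisField p D))
      (hcPoly (Fin n) (ZMod p))) ≤ D :=
    (ArithCircuit.complexity_le_size hP2 hPc).trans hPs
  have h3 : D ^ 3 ≤ D ^ 4 := Nat.pow_le_pow_right hD1 (by norm_num)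
  have h2 : D ^ 2 ≤ D ^ 4 := Nat.pow_le_pow_right hD1 (by norm_num)
  have h1 : D ≤ D ^ 4 := by
    calc D = D ^ 1 := (pow_one D).symm
      _ ≤ D ^ 4 := Nat.pow_le_pow_right hD1 (by norm_num)
  calc complexity (hcPoly (Fin n) (ZMod p))
      ≤ (5 * D ^ 3 + 6 * D ^ 2 + 2 * D) *
          complexity (MvPolynomial.map (algebraMap (ZMod p) (GaloisField p D))
            (hcPoly (Fin n) (ZMod p))) + 3 * D :=
        complexity_le_of_map_galoisField p hD0 _
    _ ≤ (5 * D ^ 3 + 6 * D ^ 2 + 2 * D) * D + 3 * D :=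
        Nat.add_le_add_right (Nat.mul_le_mul_left _ hL) _
    _ = 5 * (D ^ 3 * D) + 6 * (D ^ 2 * D) + 2 * (D * D) + 3 * D := by ring
    _ ≤ 5 * D ^ 4 + 6 * D ^ 4 + 2 * D ^ 4 + 3 * D ^ 4 := by
        have e3 : D ^ 3 * D = D ^ 4 := by ring
        have e2 : D ^ 2 * D ≤ D ^ 4 := by
          calc D ^ 2 * D = D ^ 3 := by ring
            _ ≤ D ^ 4 := h3
        have e1 : D * D ≤ D ^ 4 := by
          calc D * D = D ^ 2 := by ring
            _ ≤ D ^ 4 := h2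
        rw [e3]
        exact Nat.add_le_add (Nat.add_le_add (Nat.add_le_add le_rfl (Nat.mul_le_mul_left _ e2))
          (Nat.mul_le_mul_left _ e1)) (Nat.mul_le_mul_left _ h1)
    _ = 16 * D ^ 4 := by ring
    _ = 16 * (n + 1) ^ (4 * c) := by rw [hD, ← pow_mul, mul_comm c 4]

/-- **Item `FpBarDegreeCollapse` (stmt-ValiantsHypothesis-21046), verbatim: the degree-bounded
`𝔽̄_p` collapse.** For a prime `p` and a constant `c`, if every Hamiltonian-cycle polynomial
`HC_n` has a fan-in-two circuit of size `≤ (n+1)^c` with constants in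
`GaloisField p ((n+1)^c)` computing the image of `hcPoly (Fin n) (ZMod p)`, then `NP ⊆ P/poly`.
Proof: restriction of scalars puts `HC` in `VP` over `𝔽_p`; `HC` is `VNP`-complete over every
field (Valiant), so `VP_{𝔽_p} = VNP_{𝔽_p}`; Bürgisser 2000 TCS Cor. 1.2(2) (finite fields,
unconditional, in the tree) gives `NP ⊆ P/poly`. -/
theorem fpBarDegreeCollapse_proof :
    ∀ (p : ℕ) [Fact p.Prime] (c : ℕ), (∀ n : ℕ, ∃ P : Literature.Computability.AlgebraicComplexity.ArithCircuit (GaloisField p ((n + 1) ^ c)) (Fin n × Fin n), P.IsFanInTwo ∧ P.Computes (MvPolynomial.map (algebraMap (ZMod p) (GaloisField p ((n + 1) ^ c))) (Literature.Computability.AlgebraicComplexity.hcPoly (Fin n) (ZMod p))) ∧ P.size ≤ (n + 1) ^ c) → Literature.Computability.Complexity.Nondeterministic.NP ⊆ Literature.Computability.Complexity.PPoly := by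
  intro p _ c h
  haveI : NeZero p := ⟨(Fact.out : p.Prime).ne_zero⟩
  have hcomplete := isVNPComplete_hcPoly_holds (ZMod p)
  have hVP : IsVPFamily (fun n => hcPoly (Fin n) (ZMod p)) :=
    ⟨hcomplete.1.1, isPComputable_hcPoly_zmod_of_galoisField p c h⟩
  have hEq : VP (ZMod p) = VNP (ZMod p) :=
    (VP_eq_VNP_iff_isVPFamily_of_isVNPComplete hcomplete).2 hVP
  exact NP_subset_PPoly_of_VP_eq_VNP_finite (k := ZMod p)
    polyAdvice_NP_subset_polyAdvice_ModpNP_holds (booleanPart_VP_NC_two_of_finite_holds (ZMod p)) hEq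

end Summit.ValiantsHypothesis.ValiantsHypothesis.Theorems.BoolTransfer
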